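import Literature.MathematicalPhysics.QuantumLattice.HubbardTTPrimeBoxWordExtension
import Literature.MathematicalPhysics.QuantumLattice.HubbardFillingBoxEnergyBounds
import Literature.MathematicalPhysics.QuantumLattice.HubbardNNNHoppingEnergyDensityParticleHole
import HarnessLib

/-!
# Caps on near-half-filling parameter boxes from a half-filling cap and a doped cap row
# (density chords below, particle–hole images above half filling)

Topic `MathematicalPhysics/QuantumLattice`, family `hubbard`. The energy density `n ↦ e(t, t', U, n)` is
convex (Ruelle 1969 §3.3; tree `convexOn_energyDensityTT'`, chord form
`energyDensityTT'_le_density_chord_of_mem_Icc`) and particle–hole symmetric,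
`e(t, t', U, n) = e(t, -t', U, 2 - n) + U(n - 1)` (Lieb–Wu 2003 §1 (3); tree
`energyDensityTT'_particleHole`). Hence TWO certified caps — a `t'`-cell cap ROW at a doped density
`nₐ < 1` valid at every `U ≥ 0` (the polarised-sea rows `polCap_*`) and a cap at half filling `n = 1`
valid for every `t'` and every `U ∈ [0, U₀]` (the kernel-checked antiferromagnetic Hartree–Fock planes
`afhfCap_n1_*_at`) — cap `e` on every density between them (the chord), uniformly on a parameter box
`(U, t', n) ∈ [U₁, U₂] × [s₁, s₂] × [n₁, n₂]` in the S2-seam shape `∀ θ ∈ Set.Icc ![U₁,s₁,n₁] ![U₂,s₂,n₂]`: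

* `energyDensityTT'_le_halfChord` — the pointwise chord `e(n) ≤ ((1-n)Cₐ + (n-nₐ)C₁)/(1-nₐ)`, `n ∈ [nₐ, 1]`;
* `energyDensityTT'_cap_Icc₃_of_row_of_halfCap` — the box cap BELOW half filling (`nₐ ≤ n₁ ≤ n₂ ≤ 1`):
  the chord is affine in `n`, so the claimed constant `C` is checked at `n₁` and `n₂` only;
* `energyDensityTT'_cap_Icc₃_above_half_of_row_of_halfCap` — the box cap ABOVE half filling
  (`1 ≤ n₁ ≤ n₂ ≤ 2 - n_b`) from a cap row on the IMAGE cell `t' ∈ [-s₂, -s₁]` at density `n_b` and the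
  half-filling cap, through the particle–hole map (`+ U₂(n - 1)`);
* `energyDensityTT'_cap_Icc₃_straddle_of_rows_of_halfCap` — a box with `n₁ ≤ 1 ≤ n₂` (the undoped
  parent compounds' cells `n ∈ [0.99, 1.01]`), both halves at once.

Everything is proved; no definitions; no named facts. Consumers: `Certificates/HubbardSquare_afChord_*`.

## References

* D. Ruelle, *Statistical Mechanics: Rigorous Results* (1969), §3.3 (convexity in the density). [Ruelle1969]
* E. H. Lieb, F. Y. Wu, Physica A 321 (2003) 1, §1 eq. (3) (hole–particle transformation). [LiebWuPhysicaA2003]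
-/

namespace Literature.MathematicalPhysics.QuantumLattice

namespace ThermodynamicLimit

open Set

/-- **The half-filling chord.** For `U ≥ 0`, a cap `e(t, s, U, nₐ) ≤ Cₐ` at a doped density
`0 ≤ nₐ < 1` and a cap `e(t, s, U, 1) ≤ C₁` at half filling give, for every `n ∈ [nₐ, 1]`,
`e(t, s, U, n) ≤ ((1 - n)Cₐ + (n - nₐ)C₁)/(1 - nₐ)` (convexity in the density). [cite: Ruelle1969, §3.3] -/
theorem energyDensityTT'_le_halfChord (t s : ℝ) {U : ℝ} (hU : 0 ≤ U) {na Ca C₁ : ℝ} (hna0 : 0 ≤ na)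
    (hna1 : na < 1) (ha : energyDensityTT' t s U na ≤ Ca) (h1 : energyDensityTT' t s U 1 ≤ C₁) {n : ℝ}
    (hn : n ∈ Icc na 1) :
    energyDensityTT' t s U n ≤ ((1 - n) * Ca + (n - na) * C₁) / (1 - na) :=
  energyDensityTT'_le_density_chord_of_mem_Icc t s hU hna0 hna1 (by norm_num) ha h1 hn

/-- An affine function of `n` on `[n₁, n₂]` that is `≤ C` at both ends is `≤ C` throughout. [folklore] -/
private theorem affine_le_of_ends {α β C n₁ n₂ n : ℝ} (h₁ : α + β * n₁ ≤ C) (h₂ : α + β * n₂ ≤ C)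
    (hn₁ : n₁ ≤ n) (hn₂ : n ≤ n₂) : α + β * n ≤ C := by
  rcases le_total 0 β with hb | hb
  · nlinarith
  · nlinarith

/-- **Box cap below half filling from a cap row and a half-filling cap.** A `t'`-cell cap row
`e(1, s, U, nₐ) ≤ Cₐ` (`s ∈ [s₁, s₂]`, all `U ≥ 0`) and a half-filling cap `e(1, t', U, 1) ≤ C₁` (all `t'`,
all `U ∈ [0, U₀]`) give, on the box `Set.Icc ![U₁, s₁, n₁] ![U₂, s₂, n₂]` (coordinates `(U, t', n)`,
`0 ≤ U₁`, `U₂ ≤ U₀`, `nₐ ≤ n₁`, `n₂ ≤ 1`), the cap `C` as soon as the chord is `≤ C` at `n₁` and at `n₂`.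
[cite: Ruelle1969, §3.3] -/
theorem energyDensityTT'_cap_Icc₃_of_row_of_halfCap {s₁ s₂ na Ca U₀ C₁ U₁ U₂ n₁ n₂ C : ℝ}
    (hP : ∀ U : ℝ, 0 ≤ U → ∀ s : ℝ, s₁ ≤ s → s ≤ s₂ → energyDensityTT' 1 s U na ≤ Ca)
    (hA : ∀ t' U : ℝ, 0 ≤ U → U ≤ U₀ → energyDensityTT' 1 t' U 1 ≤ C₁)
    (hna0 : 0 ≤ na) (hU₁ : 0 ≤ U₁) (hU₂ : U₂ ≤ U₀) (hn₁ : na ≤ n₁) (hn₂ : n₂ ≤ 1) (hna1 : na < 1)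
    (hC₁ : ((1 - n₁) * Ca + (n₁ - na) * C₁) / (1 - na) ≤ C)
    (hC₂ : ((1 - n₂) * Ca + (n₂ - na) * C₁) / (1 - na) ≤ C) :
    ∀ θ ∈ Set.Icc (![U₁, s₁, n₁] : Fin 3 → ℝ) ![U₂, s₂, n₂],
      energyDensityTT' 1 (θ 1) (θ 0) (θ 2) ≤ C := by
  refine forall_mem_Icc_vec3_of_forall₃ (P := fun x y z => energyDensityTT' 1 y x z ≤ C) ?_
  intro U s n hU1 hU2 hs1 hs2 hz1 hz2
  have hU : 0 ≤ U := hU₁.trans hU1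
  have hch := energyDensityTT'_le_halfChord 1 s hU hna0 hna1 (hP U hU s hs1 hs2)
    (hA s U hU (hU2.trans hU₂)) (n := n) ⟨hn₁.trans hz1, hz2.trans hn₂⟩
  have hd : 0 < 1 - na := by linarith
  -- the chord as `α + β n`
  have key : ((1 - n) * Ca + (n - na) * C₁) / (1 - na) ≤ C := by
    have e : ∀ m : ℝ, ((1 - m) * Ca + (m - na) * C₁) / (1 - na) =
        (Ca - na * C₁) / (1 - na) + ((C₁ - Ca) / (1 - na)) * m := fun m => by
      field_simp; ring
    rw [e] at hC₁ hC₂ ⊢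
    exact affine_le_of_ends hC₁ hC₂ hz1 hz2
  exact hch.trans key

/-- **Box cap above half filling through the particle–hole image.** A cap row on the IMAGE cell,
`e(1, s, U, n_b) ≤ C_b` for `s ∈ [-s₂, -s₁]`, all `U ≥ 0` (`0 ≤ n_b < 1`), and a half-filling cap
`e(1, t', U, 1) ≤ C₁` (all `t'`, `U ∈ [0, U₀]`) give, on `Set.Icc ![U₁, s₁, n₁] ![U₂, s₂, n₂]` with
`0 ≤ U₁`, `U₂ ≤ U₀`, `1 ≤ n₁`, `n₂ ≤ 2 - n_b`, `n₂ < 2`: `e ≤ C` as soon as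
`((n - 1)C_b + (1 - n_b - (n - 1))C₁)/(1 - n_b) + U₂(n - 1) ≤ C` at `n = n₁` and `n = n₂`
(`e(1,s,U,n) = e(1,-s,U,2-n) + U(n-1)`, the chord at `2 - n ∈ [n_b, 1]`, `U(n-1) ≤ U₂(n-1)`).
[cite: LiebWuPhysicaA2003, §1 eq. (3)] -/
theorem energyDensityTT'_cap_Icc₃_above_half_of_row_of_halfCap {s₁ s₂ nb Cb U₀ C₁ U₁ U₂ n₁ n₂ C : ℝ}
    (hP : ∀ U : ℝ, 0 ≤ U → ∀ s : ℝ, -s₂ ≤ s → s ≤ -s₁ → energyDensityTT' 1 s U nb ≤ Cb)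
    (hA : ∀ t' U : ℝ, 0 ≤ U → U ≤ U₀ → energyDensityTT' 1 t' U 1 ≤ C₁)
    (hnb0 : 0 ≤ nb) (hnb1 : nb < 1) (hU₁ : 0 ≤ U₁) (hU₂ : U₂ ≤ U₀) (hn₁ : 1 ≤ n₁) (hn₂ : n₂ ≤ 2 - nb)
    (hn₂' : n₂ < 2)
    (hC₁ : ((n₁ - 1) * Cb + (1 - nb - (n₁ - 1)) * C₁) / (1 - nb) + U₂ * (n₁ - 1) ≤ C)
    (hC₂ : ((n₂ - 1) * Cb + (1 - nb - (n₂ - 1)) * C₁) / (1 - nb) + U₂ * (n₂ - 1) ≤ C) :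
    ∀ θ ∈ Set.Icc (![U₁, s₁, n₁] : Fin 3 → ℝ) ![U₂, s₂, n₂],
      energyDensityTT' 1 (θ 1) (θ 0) (θ 2) ≤ C := by
  refine forall_mem_Icc_vec3_of_forall₃ (P := fun x y z => energyDensityTT' 1 y x z ≤ C) ?_
  intro U s n hU1 hU2 hs1 hs2 hz1 hz2
  have hU : 0 ≤ U := hU₁.trans hU1
  have hn0 : 0 < n := by linarith
  have hn2 : n < 2 := by linarith
  rw [energyDensityTT'_particleHole 1 s hU hn0 hn2]
  have hch := energyDensityTT'_le_halfChord 1 (-s) hU hnb0 hnb1 (hP U hU (-s) (by linarith) (by linarith))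
    (hA (-s) U hU (hU2.trans hU₂)) (n := 2 - n) ⟨by linarith, by linarith⟩
  have hd : 0 < 1 - nb := by linarith
  have hUn : U * (n - 1) ≤ U₂ * (n - 1) := mul_le_mul_of_nonneg_right hU2 (by linarith)
  have key : ((1 - (2 - n)) * Cb + ((2 - n) - nb) * C₁) / (1 - nb) + U₂ * (n - 1) ≤ C := by
    have e : ∀ m : ℝ, ((1 - (2 - m)) * Cb + ((2 - m) - nb) * C₁) / (1 - nb) + U₂ * (m - 1) =
        ((-Cb + (2 - nb) * C₁) / (1 - nb) - U₂) + ((Cb - C₁) / (1 - nb) + U₂) * m := fun m => by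
      field_simp; ring
    have e₁ : ((n₁ - 1) * Cb + (1 - nb - (n₁ - 1)) * C₁) / (1 - nb) + U₂ * (n₁ - 1) =
        ((-Cb + (2 - nb) * C₁) / (1 - nb) - U₂) + ((Cb - C₁) / (1 - nb) + U₂) * n₁ := by
      field_simp; ring
    have e₂ : ((n₂ - 1) * Cb + (1 - nb - (n₂ - 1)) * C₁) / (1 - nb) + U₂ * (n₂ - 1) =
        ((-Cb + (2 - nb) * C₁) / (1 - nb) - U₂) + ((Cb - C₁) / (1 - nb) + U₂) * n₂ := by
      field_simp; ring
    rw [e]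
    rw [e₁] at hC₁
    rw [e₂] at hC₂
    exact affine_le_of_ends hC₁ hC₂ hz1 hz2
  linarith

/-- **Box cap straddling half filling** (the undoped parents' cells `n₁ ≤ 1 ≤ n₂`; stated for any
`nₐ ≤ n₁`, `n₂ ≤ 2 - n_b`): the two previous caps on `[n₁, 1]` and `[1, n₂]` glued, the half-filling cap
`C₁ ≤ C` serving as the common end. [cite: Ruelle1969, §3.3] -/
theorem energyDensityTT'_cap_Icc₃_straddle_of_rows_of_halfCap
    {s₁ s₂ na Ca nb Cb U₀ C₁ U₁ U₂ n₁ n₂ C : ℝ}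
    (hP : ∀ U : ℝ, 0 ≤ U → ∀ s : ℝ, s₁ ≤ s → s ≤ s₂ → energyDensityTT' 1 s U na ≤ Ca)
    (hPimg : ∀ U : ℝ, 0 ≤ U → ∀ s : ℝ, -s₂ ≤ s → s ≤ -s₁ → energyDensityTT' 1 s U nb ≤ Cb)
    (hA : ∀ t' U : ℝ, 0 ≤ U → U ≤ U₀ → energyDensityTT' 1 t' U 1 ≤ C₁)
    (hna0 : 0 ≤ na) (hna1 : na < 1) (hnb0 : 0 ≤ nb) (hnb1 : nb < 1) (hU₁ : 0 ≤ U₁) (hU₂ : U₂ ≤ U₀)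
    (hn₁ : na ≤ n₁) (hn₂' : n₂ ≤ 2 - nb) (hn₂'' : n₂ < 2)
    (hC₁ : ((1 - n₁) * Ca + (n₁ - na) * C₁) / (1 - na) ≤ C) (hC₀ : C₁ ≤ C)
    (hC₂ : ((n₂ - 1) * Cb + (1 - nb - (n₂ - 1)) * C₁) / (1 - nb) + U₂ * (n₂ - 1) ≤ C) :
    ∀ θ ∈ Set.Icc (![U₁, s₁, n₁] : Fin 3 → ℝ) ![U₂, s₂, n₂],
      energyDensityTT' 1 (θ 1) (θ 0) (θ 2) ≤ C := by
  have hd : 0 < 1 - na := by linarith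
  have hd' : 0 < 1 - nb := by linarith
  have hlow := energyDensityTT'_cap_Icc₃_of_row_of_halfCap (n₂ := 1) hP hA hna0 hU₁ hU₂ hn₁ le_rfl hna1
    hC₁ (by rw [show ((1 - 1) * Ca + (1 - na) * C₁) / (1 - na) = C₁ by field_simp; ring]; exact hC₀)
  have hup := energyDensityTT'_cap_Icc₃_above_half_of_row_of_halfCap (n₁ := 1) hPimg hA hnb0 hnb1 hU₁
    hU₂ le_rfl hn₂' hn₂''
    (by rw [show ((1 - 1) * Cb + (1 - nb - (1 - 1)) * C₁) / (1 - nb) + U₂ * (1 - 1) = C₁ by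
      field_simp; ring]; exact hC₀) hC₂
  refine forall_mem_Icc_vec3_of_forall₃ (P := fun x y z => energyDensityTT' 1 y x z ≤ C) ?_
  intro U s n hU1 hU2 hs1 hs2 hz1 hz2
  rcases le_total n 1 with hn | hn
  · exact forall₃_of_forall_mem_Icc_vec3 (P := fun x y z => energyDensityTT' 1 y x z ≤ C) hlow
      hU1 hU2 hs1 hs2 hz1 hn
  · exact forall₃_of_forall_mem_Icc_vec3 (P := fun x y z => energyDensityTT' 1 y x z ≤ C) hup
      hU1 hU2 hs1 hs2 hn hz2

end ThermodynamicLimit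

end Literature.MathematicalPhysics.QuantumLattice
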